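import Summits.NavierStokesRegularity.NavierStokesRegularity.Theorems.ExtremiserTransienceNearExtremalTransienceExtremiserLiouvilleConstantSpeedSlabEnergy
import Mathlib.MeasureTheory.Integral.Prod
import HarnessLib

/-!
# Crux `ExtremiserTransience.NearExtremalTransience` (stmt-NavierStokesRegularity-21883), line `extremiser_liouville`,
# stub K1b — SLAB ENERGIES of the residue object, part 2: sandwich by indicator slabs and `F(0) = E₀`

`--supports stmt-NavierStokesRegularity-21883` (helper).  Author: prover seat `ns-el-k1b` (g5).  Continues
`…ConstantSpeedSlabEnergy` (`∫ (H(x₂ − s) − H(x₂ − s − N))‖V‖² = N·F(0)`, `F(0) = ∫ B(x₂)‖V‖²`, `B = H − H(· − 1)`).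

* `integral_indicator_slab_mul_sq_le` / `le_integral_indicator_slab_mul_sq` :
  `∫_{s+1 ≤ x₂ ≤ s+N}‖V‖² ≤ N·F(0) ≤ ∫_{s ≤ x₂ ≤ s+N+1}‖V‖²` (`𝟙_{[1,N]} ≤ H − H(· − N) ≤ 𝟙_{[0,N+1]}`);
* `integral_bump_window_mul_sq_eq_windowEnergy` : **`F(0) = E₀`** when the `H′`-window energies `∫ H′(x₂ − u)‖V‖²` equal
  `E₀` for `u ∈ [0,1]` (`B = ∫_0^1 H′(· − u) du`, Fubini);
* `slabEnergy_sandwich_of_windowEnergy` : for the residue JET (`E(s) ≡ E₀`, `…ConstantSpeedEnergyFluxJet`)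
  **`∫_{s+1 ≤ x₂ ≤ s+N}‖w − c‖² ≤ N·E₀ ≤ ∫_{s ≤ x₂ ≤ s+N+1}‖w − c‖²`**: every axial slab of length `N` carries energy
  `N·E₀ + O(E₀)` — the input "`∫_{slab}‖V‖² = L·E₀`" of the truncation estimates (record §5).

WHAT THIS IS NOT: K1b is NOT proved; nothing here proves NS regularity. [folklore]
-/

noncomputable section

open Set Filter Topology MeasureTheory Metric Function
open scoped ENNReal NNReal Topology InnerProductSpace RealInnerProductSpace ContDiff
open Literature.Analysis.FluidPDE Literature.Analysis

namespace Summit.NavierStokesRegularity.NavierStokesRegularity.Theorems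

-- the problem directory repeats the summit name (`NavierStokesRegularity/NavierStokesRegularity`)
set_option linter.dupNamespace false

namespace ExtremiserLiouville

variable {V : EuclideanSpace ℝ (Fin 3) → EuclideanSpace ℝ (Fin 3)} {c : EuclideanSpace ℝ (Fin 3)}

/-! ## Sandwich by indicator slabs -/

/-- `𝟙_{[1,N]}(z) ≤ H(z) − H(z − N)`. [folklore] -/
theorem indicator_Icc_le_smoothTransition_sub (z : ℝ) (N : ℕ) :
    (Icc (1 : ℝ) N).indicator (fun _ => (1 : ℝ)) z ≤ Real.smoothTransition z - Real.smoothTransition (z - N) := by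
  by_cases hz : z ∈ Icc (1 : ℝ) N
  · rw [indicator_of_mem hz, Real.smoothTransition.one_of_one_le hz.1,
      Real.smoothTransition.zero_of_nonpos (by linarith [hz.2])]
    simp
  · rw [indicator_of_notMem hz]
    exact sub_nonneg.2 (Real.smoothTransition.monotone (by linarith [(N.cast_nonneg : (0 : ℝ) ≤ N)]))

/-- `H(z) − H(z − N) ≤ 𝟙_{[0,N+1]}(z)`. [folklore] -/
theorem smoothTransition_sub_le_indicator_Icc (z : ℝ) (N : ℕ) :
    Real.smoothTransition z - Real.smoothTransition (z - N) ≤ (Icc (0 : ℝ) (N + 1)).indicator (fun _ => (1 : ℝ)) z := by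
  by_cases hz : z ∈ Icc (0 : ℝ) (N + 1)
  · rw [indicator_of_mem hz]
    linarith [Real.smoothTransition.le_one z, Real.smoothTransition.nonneg (z - N)]
  · rw [indicator_of_notMem hz]
    rw [mem_Icc, not_and_or, not_le, not_le] at hz
    rcases hz with h | h
    · rw [Real.smoothTransition.zero_of_nonpos h.le,
        Real.smoothTransition.zero_of_nonpos (by linarith [(N.cast_nonneg : (0 : ℝ) ≤ N)]), sub_self]
    · rw [Real.smoothTransition.one_of_one_le (by linarith), Real.smoothTransition.one_of_one_le (by linarith),
        sub_self]

/-- The slab `{a ≤ x₂ ≤ b}` is measurable. [folklore] -/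
theorem measurableSet_slab (a b : ℝ) : MeasurableSet {x : EuclideanSpace ℝ (Fin 3) | a ≤ x 2 ∧ x 2 ≤ b} := by
  have h2 : Continuous fun x : EuclideanSpace ℝ (Fin 3) => x 2 := PiLp.continuous_apply 2 _ (2 : Fin 3)
  exact ((isClosed_le continuous_const h2).inter (isClosed_le h2 continuous_const)).measurableSet

/-- A slab density `𝟙_{a ≤ x₂ ≤ b}‖V‖²` inside `{|x₂| ≤ T}` is integrable. [folklore] -/
theorem integrable_indicator_slab_mul_sq (hV : Continuous V) {T a b : ℝ} (ha : -T ≤ a) (hb : b ≤ T)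
    (hL2 : Integrable (fun x => {x : EuclideanSpace ℝ (Fin 3) | |x 2| ≤ T}.indicator (fun x => ‖V x‖ ^ 2) x) volume) :
    Integrable (fun x => {x : EuclideanSpace ℝ (Fin 3) | a ≤ x 2 ∧ x 2 ≤ b}.indicator (fun x => ‖V x‖ ^ 2) x)
      volume := by
  refine hL2.mono' ((hV.norm.pow 2).aestronglyMeasurable.indicator (measurableSet_slab a b))
    (Eventually.of_forall fun x => ?_)
  by_cases hx : x ∈ {x : EuclideanSpace ℝ (Fin 3) | a ≤ x 2 ∧ x 2 ≤ b}
  · have hx' : x ∈ {x : EuclideanSpace ℝ (Fin 3) | |x 2| ≤ T} := by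
      show |x 2| ≤ T
      rw [abs_le]; exact ⟨by linarith [hx.1], by linarith [hx.2]⟩
    rw [indicator_of_mem hx, indicator_of_mem hx', Real.norm_eq_abs, abs_of_nonneg (sq_nonneg _)]
  · rw [indicator_of_notMem hx, norm_zero]; exact indicator_nonneg (fun _ _ => sq_nonneg _) _

/-- **Lower sandwich.**  `∫_{s+1 ≤ x₂ ≤ s+N}‖V‖² ≤ N · F(0)` (`|s| + N + 2 ≤ T`). [folklore] -/
theorem integral_indicator_slab_mul_sq_le (hV : ContDiff ℝ 1 V) (hdiv : VectorCalculus.IsDivFree V)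
    (hVc : ∀ x, ⟪V x, c⟫ = -(‖V x‖ ^ 2 / 2)) (hc0 : c 0 = 0) (hc1 : c 1 = 0) (hc2 : c 2 ≠ 0)
    {T s : ℝ} {N : ℕ} (hs : |s| + N + 2 ≤ T)
    (hL2 : Integrable (fun x => {x : EuclideanSpace ℝ (Fin 3) | |x 2| ≤ T}.indicator (fun x => ‖V x‖ ^ 2) x) volume) :
    (∫ x, {x : EuclideanSpace ℝ (Fin 3) | s + 1 ≤ x 2 ∧ x 2 ≤ s + N}.indicator (fun x => ‖V x‖ ^ 2) x) ≤
      N * ∫ x, (Real.smoothTransition (x 2) - Real.smoothTransition (x 2 - 1)) * ‖V x‖ ^ 2 := by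
  rw [← integral_step_window_mul_sq_eq hV hdiv hVc hc0 hc1 hc2 hs hL2]
  have hN : (0 : ℝ) ≤ N := N.cast_nonneg
  refine integral_mono (integrable_indicator_slab_mul_sq hV.continuous (by linarith [neg_abs_le s])
    (by linarith [le_abs_self s]) hL2) ?_ fun x => ?_
  · exact integrable_step_window_mul_sq hV.continuous hs hL2
  · -- pointwise: `𝟙_{[s+1,s+N]}(x₂)‖V‖² ≤ (H(x₂−s) − H(x₂−s−N))‖V‖²`
    have h := indicator_Icc_le_smoothTransition_sub (x 2 - s) N
    have e : {x : EuclideanSpace ℝ (Fin 3) | s + 1 ≤ x 2 ∧ x 2 ≤ s + N}.indicator (fun x => ‖V x‖ ^ 2) x =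
        (Icc (1 : ℝ) N).indicator (fun _ => (1 : ℝ)) (x 2 - s) * ‖V x‖ ^ 2 := by
      by_cases hx : x ∈ {x : EuclideanSpace ℝ (Fin 3) | s + 1 ≤ x 2 ∧ x 2 ≤ s + N}
      · have hx' : x 2 - s ∈ Icc (1 : ℝ) N := ⟨by linarith [hx.1], by linarith [hx.2]⟩
        rw [indicator_of_mem hx, indicator_of_mem hx', one_mul]
      · have hx' : x 2 - s ∉ Icc (1 : ℝ) N := fun h' => hx ⟨by linarith [h'.1], by linarith [h'.2]⟩
        rw [indicator_of_notMem hx, indicator_of_notMem hx', zero_mul]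
    rw [e]
    exact mul_le_mul_of_nonneg_right h (sq_nonneg _)

/-- **Upper sandwich.**  `N · F(0) ≤ ∫_{s ≤ x₂ ≤ s+N+1}‖V‖²` (`|s| + N + 2 ≤ T`). [folklore] -/
theorem le_integral_indicator_slab_mul_sq (hV : ContDiff ℝ 1 V) (hdiv : VectorCalculus.IsDivFree V)
    (hVc : ∀ x, ⟪V x, c⟫ = -(‖V x‖ ^ 2 / 2)) (hc0 : c 0 = 0) (hc1 : c 1 = 0) (hc2 : c 2 ≠ 0)
    {T s : ℝ} {N : ℕ} (hs : |s| + N + 2 ≤ T)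
    (hL2 : Integrable (fun x => {x : EuclideanSpace ℝ (Fin 3) | |x 2| ≤ T}.indicator (fun x => ‖V x‖ ^ 2) x) volume) :
    N * (∫ x, (Real.smoothTransition (x 2) - Real.smoothTransition (x 2 - 1)) * ‖V x‖ ^ 2) ≤
      ∫ x, {x : EuclideanSpace ℝ (Fin 3) | s ≤ x 2 ∧ x 2 ≤ s + N + 1}.indicator (fun x => ‖V x‖ ^ 2) x := by
  rw [← integral_step_window_mul_sq_eq hV hdiv hVc hc0 hc1 hc2 hs hL2]
  have hN : (0 : ℝ) ≤ N := N.cast_nonneg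
  refine integral_mono ?_ (integrable_indicator_slab_mul_sq hV.continuous (by linarith [neg_abs_le s])
    (by linarith [le_abs_self s]) hL2) fun x => ?_
  · exact integrable_step_window_mul_sq hV.continuous hs hL2
  · have h := smoothTransition_sub_le_indicator_Icc (x 2 - s) N
    have e : {x : EuclideanSpace ℝ (Fin 3) | s ≤ x 2 ∧ x 2 ≤ s + N + 1}.indicator (fun x => ‖V x‖ ^ 2) x =
        (Icc (0 : ℝ) (N + 1)).indicator (fun _ => (1 : ℝ)) (x 2 - s) * ‖V x‖ ^ 2 := by
      by_cases hx : x ∈ {x : EuclideanSpace ℝ (Fin 3) | s ≤ x 2 ∧ x 2 ≤ s + N + 1}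
      · have hx' : x 2 - s ∈ Icc (0 : ℝ) (N + 1) := ⟨by linarith [hx.1], by linarith [hx.2]⟩
        rw [indicator_of_mem hx, indicator_of_mem hx', one_mul]
      · have hx' : x 2 - s ∉ Icc (0 : ℝ) (N + 1) := fun h' => hx ⟨by linarith [h'.1], by linarith [h'.2]⟩
        rw [indicator_of_notMem hx, indicator_of_notMem hx', zero_mul]
    rw [e]
    exact mul_le_mul_of_nonneg_right h (sq_nonneg _)

/-! ## Identification of the bump-window energy with the `H′`-window energy `E₀` (Fubini) -/

/-- `B(z) = ∫_0^1 H′(z − u) du`. [folklore] -/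
theorem smoothTransition_sub_eq_intervalIntegral_deriv (z : ℝ) :
    Real.smoothTransition z - Real.smoothTransition (z - 1) =
      ∫ u in (0 : ℝ)..1, deriv Real.smoothTransition (z - u) := by
  have hdiffH : Differentiable ℝ Real.smoothTransition := Literature.Analysis.Calculus.differentiable_smoothTransition
  have hcont : Continuous (deriv Real.smoothTransition) := Real.smoothTransition.contDiff.continuous_deriv le_rfl
  rw [intervalIntegral.integral_comp_sub_left (fun w => deriv Real.smoothTransition w) z, sub_zero,
    intervalIntegral.integral_deriv_eq_sub (fun w _ => hdiffH w) (hcont.intervalIntegrable _ _)]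

/-- **`F(0) = E₀`.**  If `V` is continuous, `‖V‖² ∈ L¹({|x₂| ≤ T})` with `2 ≤ T`, and the `H′`-window energies
`E(u) = ∫ H′(x₂ − u)‖V x‖² dx` equal `E₀` for `u ∈ [0,1]`, then the bump-window energy `∫ B(x₂)‖V x‖² dx` equals `E₀`
(`B = ∫_0^1 H′(· − u) du` and Fubini). [folklore] -/
theorem integral_bump_window_mul_sq_eq_windowEnergy (hV : Continuous V) {T : ℝ} (hT : 2 ≤ T)
    (hL2 : Integrable (fun x => {x : EuclideanSpace ℝ (Fin 3) | |x 2| ≤ T}.indicator (fun x => ‖V x‖ ^ 2) x) volume)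
    {E₀ : ℝ} (hE : ∀ u ∈ Icc (0 : ℝ) 1, (∫ x : EuclideanSpace ℝ (Fin 3),
      deriv Real.smoothTransition (x 2 - u) * ‖V x‖ ^ 2) = E₀) :
    (∫ x : EuclideanSpace ℝ (Fin 3), (Real.smoothTransition (x 2) - Real.smoothTransition (x 2 - 1)) * ‖V x‖ ^ 2) =
      E₀ := by
  obtain ⟨A, hA, hHA⟩ := Literature.Analysis.Calculus.exists_bound_deriv_smoothTransition
  have hHc : Continuous (deriv Real.smoothTransition) := Real.smoothTransition.contDiff.continuous_deriv le_rfl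
  set f : EuclideanSpace ℝ (Fin 3) → ℝ → ℝ := fun x u =>
    (Ioc (0 : ℝ) 1).indicator (fun _ => (1 : ℝ)) u * (deriv Real.smoothTransition (x 2 - u) * ‖V x‖ ^ 2) with hfdef
  -- (1) the integrand is the `u`-integral of `f x u`
  have h1 : ∀ x : EuclideanSpace ℝ (Fin 3),
      (Real.smoothTransition (x 2) - Real.smoothTransition (x 2 - 1)) * ‖V x‖ ^ 2 = ∫ u, f x u := by
    intro x
    rw [smoothTransition_sub_eq_intervalIntegral_deriv, ← intervalIntegral.integral_mul_const,
      intervalIntegral.integral_of_le zero_le_one, ← integral_indicator measurableSet_Ioc]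
    refine integral_congr_ae (Eventually.of_forall fun u => ?_)
    show (Ioc (0 : ℝ) 1).indicator (fun u => deriv Real.smoothTransition (x 2 - u) * ‖V x‖ ^ 2) u = f x u
    by_cases hu : u ∈ Ioc (0 : ℝ) 1
    · rw [indicator_of_mem hu, hfdef]; dsimp only; rw [indicator_of_mem hu, one_mul]
    · rw [indicator_of_notMem hu, hfdef]; dsimp only; rw [indicator_of_notMem hu, zero_mul]
  -- (2) integrability on the product: `|f x u| ≤ 𝟙_{|x₂| ≤ T}‖V x‖² · A𝟙_{(0,1]}(u)`
  have hg : Integrable (fun u : ℝ => (Ioc (0 : ℝ) 1).indicator (fun _ => A) u) volume := by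
    rw [integrable_indicator_iff measurableSet_Ioc]
    exact ((continuous_const (y := A)).integrableOn_Icc (a := (0 : ℝ)) (b := 1)).mono_set Ioc_subset_Icc_self
  have hint : Integrable (uncurry f) (volume.prod volume) := by
    refine (hL2.mul_prod hg).mono' ?_ (Eventually.of_forall fun z => ?_)
    · have hc : Continuous fun z : EuclideanSpace ℝ (Fin 3) × ℝ =>
          deriv Real.smoothTransition (z.1 2 - z.2) * ‖V z.1‖ ^ 2 :=
        (hHc.comp (((PiLp.continuous_apply 2 _ (2 : Fin 3)).comp continuous_fst).sub continuous_snd)).mul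
          ((hV.comp continuous_fst).norm.pow 2)
      exact (((measurable_const (a := (1 : ℝ))).indicator measurableSet_Ioc).comp
        measurable_snd).aestronglyMeasurable.mul hc.aestronglyMeasurable
    · show ‖f z.1 z.2‖ ≤ {x : EuclideanSpace ℝ (Fin 3) | |x 2| ≤ T}.indicator (fun x => ‖V x‖ ^ 2) z.1 *
        (Ioc (0 : ℝ) 1).indicator (fun _ => A) z.2
      rw [hfdef]; dsimp only
      by_cases hu : z.2 ∈ Ioc (0 : ℝ) 1
      · rw [indicator_of_mem hu, indicator_of_mem hu, one_mul, Real.norm_eq_abs, abs_mul,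
          abs_of_nonneg (sq_nonneg ‖V z.1‖)]
        by_cases hd : deriv Real.smoothTransition (z.1 2 - z.2) = 0
        · rw [hd, abs_zero, zero_mul]
          exact mul_nonneg (indicator_nonneg (fun _ _ => sq_nonneg _) _) hA
        · obtain ⟨hl, hr⟩ := pos_and_lt_one_of_deriv_smoothTransition_ne_zero hd
          have hx : z.1 ∈ {x : EuclideanSpace ℝ (Fin 3) | |x 2| ≤ T} := by
            show |z.1 2| ≤ T
            rw [abs_le]; constructor <;> linarith [hu.1, hu.2]
          rw [indicator_of_mem hx, mul_comm (‖V z.1‖ ^ 2) A]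
          exact mul_le_mul_of_nonneg_right (hHA _) (sq_nonneg _)
      · rw [indicator_of_notMem hu, indicator_of_notMem hu, zero_mul, mul_zero, norm_zero]
  -- (3) Fubini
  rw [integral_congr_ae (Eventually.of_forall h1 :
    (fun x : EuclideanSpace ℝ (Fin 3) => (Real.smoothTransition (x 2) - Real.smoothTransition (x 2 - 1)) *
      ‖V x‖ ^ 2) =ᵐ[volume] fun x => ∫ u, f x u), integral_integral_swap hint]
  -- (4) the inner `x`-integral is `E₀` on `(0,1]` and `0` elsewhere
  have h3 : ∀ u : ℝ, (∫ x, f x u) = (Ioc (0 : ℝ) 1).indicator (fun _ => E₀) u := by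
    intro u
    by_cases hu : u ∈ Ioc (0 : ℝ) 1
    · rw [indicator_of_mem hu, hfdef]; dsimp only
      simp_rw [indicator_of_mem hu, one_mul]
      exact hE u (Ioc_subset_Icc_self hu)
    · rw [indicator_of_notMem hu, hfdef]; dsimp only
      simp_rw [indicator_of_notMem hu, zero_mul, integral_zero]
  rw [integral_congr_ae (Eventually.of_forall h3 :
    (fun u : ℝ => ∫ x, f x u) =ᵐ[volume] fun u => (Ioc (0 : ℝ) 1).indicator (fun _ => E₀) u),
    integral_indicator_const _ measurableSet_Ioc, Real.volume_real_Ioc, smul_eq_mul]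
  rw [sub_zero, max_eq_left zero_le_one, one_mul]

/-- **Slab energies of a jet.**  If moreover the `H′`-window energies are `≡ E₀` on `[0,1]` (the JET constant of
`…ConstantSpeedEnergyFluxJet`), then for `N ∈ ℕ`, `|s| + N + 2 ≤ T`:
**`∫_{s+1 ≤ x₂ ≤ s+N}‖V‖² ≤ N·E₀ ≤ ∫_{s ≤ x₂ ≤ s+N+1}‖V‖²`** — every axial slab of length `N` of the residue jet carries
energy `N·E₀ + O(E₀)`. [folklore] -/
theorem slabEnergy_sandwich_of_windowEnergy (hV : ContDiff ℝ 1 V) (hdiv : VectorCalculus.IsDivFree V)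
    (hVc : ∀ x, ⟪V x, c⟫ = -(‖V x‖ ^ 2 / 2)) (hc0 : c 0 = 0) (hc1 : c 1 = 0) (hc2 : c 2 ≠ 0)
    {T s : ℝ} {N : ℕ} (hs : |s| + N + 2 ≤ T)
    (hL2 : Integrable (fun x => {x : EuclideanSpace ℝ (Fin 3) | |x 2| ≤ T}.indicator (fun x => ‖V x‖ ^ 2) x) volume)
    {E₀ : ℝ} (hE : ∀ u ∈ Icc (0 : ℝ) 1, (∫ x : EuclideanSpace ℝ (Fin 3),
      deriv Real.smoothTransition (x 2 - u) * ‖V x‖ ^ 2) = E₀) :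
    (∫ x, {x : EuclideanSpace ℝ (Fin 3) | s + 1 ≤ x 2 ∧ x 2 ≤ s + N}.indicator (fun x => ‖V x‖ ^ 2) x) ≤ N * E₀ ∧
      N * E₀ ≤ ∫ x, {x : EuclideanSpace ℝ (Fin 3) | s ≤ x 2 ∧ x 2 ≤ s + N + 1}.indicator (fun x => ‖V x‖ ^ 2) x := by
  have hT : 2 ≤ T := by linarith [abs_nonneg s, (N.cast_nonneg : (0 : ℝ) ≤ N)]
  rw [← integral_bump_window_mul_sq_eq_windowEnergy hV.continuous hT hL2 hE]
  exact ⟨integral_indicator_slab_mul_sq_le hV hdiv hVc hc0 hc1 hc2 hs hL2,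
    le_integral_indicator_slab_mul_sq hV hdiv hVc hc0 hc1 hc2 hs hL2⟩

end ExtremiserLiouville

end Summit.NavierStokesRegularity.NavierStokesRegularity.Theorems

end
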